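import Summits.Ventures.PercRepro.C028Transfer

/-!
# C-028 per graph: the class form on the marked minors of ONE graph gives the row on that graph
(typer-2, gen 11; lead RULING (mw))

`C028_of_C028Class` (C028Transfer) consumes the class statement `C028Class` ONLY on the marked
minors `(G.minor u v, sure classes of a, b, c)`, `v ≤ u`, of the graph `G` at hand.  This file
records that dependency per graph, so that a census of the class form on the marked minors of the
censused graphs (mine-4's kit j188195: every marked contraction minor of every graph on
`n ≤ 7` vertices and on `n = 8` vertices with `m ≤ 16` edges) is a census of the ROW at every
`p ∈ [0, 1]^E` on exactly those graphs:

* **`C028ClassOn G`** — `badbot² ≤ ac · bc` (`kernel28`, `rowKernel3 2`, `rowKernel3 3` as cube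
  sums) on every marked minor `G.minor u v` of `G` with the marks `G.sureClass v a`, `…b`, `…c`
  (all `u v : Config E`, all `a b c : V`; the minors with `¬ v ≤ u` are included for simplicity —
  they are harmless extra instances, the proof uses only `v ≤ u`);
* **`C028On G`** — the row `(x + y₁)(y₁ + z) − y₁ ≤ √(y₂ · y₃)` on `G` at every `p`, every marking;
* **`C028On_of_C028ClassOn`** — the transfer per graph (the proof of `C028_of_C028Class`, with the
  hypothesis applied per minor);
* **`C028ClassOn_of_C028Class`** and **`C028_of_C028Class'`** — the global statement re-derived
  through the per-graph one (a consistency check: `C028_of_C028Class'` has the type of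
  `C028_of_C028Class`).

No new mathematics: the per-graph wrapper is the landed route restricted to one graph.
-/

namespace PercRepro

open Finset

namespace MultiGraph

variable {V E : Type*} (G : MultiGraph V E) [Fintype E] [DecidableEq E]

/-- **The class form of C-028 on every marked minor of `G`**: for all configurations `u v` and
marks `a b c` of `G`, on the marked minor `G.minor u v` (edges in `v` contracted, edges outside `u`
deleted) with marks the sure classes of `a`, `b`, `c`,
`badbot² ≤ ac · bc` — `(cubeSumQuad kernel28)² ≤ cubeSumQuad (rowKernel3 2) · cubeSumQuad (rowKernel3 3)`.
This is exactly the family of instances of `C028Class` that `C028_of_C028Class` uses for `G`. -/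
def C028ClassOn : Prop :=
  ∀ (u v : Config E) (a b c : V),
    ((G.minor u v).cubeSumQuad (fun i => G.sureClass v (![a, b, c] i)) kernel28) ^ 2 ≤
      (G.minor u v).cubeSumQuad (fun i => G.sureClass v (![a, b, c] i)) (rowKernel3 2) *
        (G.minor u v).cubeSumQuad (fun i => G.sureClass v (![a, b, c] i)) (rowKernel3 3)

/-- **C-028 on the graph `G`**: for every `p ∈ [0,1]^E` and marks `a b c`,
`(x + y₁)(y₁ + z) − y₁ ≤ √(y₂ · y₃)` on the `law3` rows of `G` (the body of `C028` for this `G`). -/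
def C028On : Prop :=
  ∀ (p : E → ℝ), IsProb p → ∀ a b c : V,
    (G.law3 p a b c 0 + G.law3 p a b c 1) * (G.law3 p a b c 1 + G.law3 p a b c 4) -
        G.law3 p a b c 1 ≤
      Real.sqrt (G.law3 p a b c 2 * G.law3 p a b c 3)

/-- **The per-graph transfer** `C028ClassOn G → C028On G`: the proof of `C028_of_C028Class`
(`quadForm_eq_sum_faces`, `faceSumQuad_eq_minor`, weighted Cauchy–Schwarz
`Finset.sum_sq_le_sum_mul_sum_of_sq_le_mul`, `Real.le_sqrt_of_sq_le`) with the class hypothesis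
applied only on the marked minors of `G`. -/
theorem C028On_of_C028ClassOn (h : G.C028ClassOn) : G.C028On := by
  intro p hp a b c
  rw [← G.quadForm_kernel28 p a b c, ← G.quadForm_rowKernel3 p a b c 2,
    ← G.quadForm_rowKernel3 p a b c 3]
  apply Real.le_sqrt_of_sq_le
  rw [G.quadForm_eq_sum_faces, G.quadForm_eq_sum_faces, G.quadForm_eq_sum_faces]
  have hw : ∀ uv : Config E × Config E, 0 ≤ weight p uv.2 * weight p uv.1 :=
    fun uv => mul_nonneg (weight_nonneg hp _) (weight_nonneg hp _)
  refine Finset.sum_sq_le_sum_mul_sum_of_sq_le_mul _ ?_ ?_ ?_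
  · intro uv _
    refine mul_nonneg (hw uv) ?_
    split_ifs
    · exact G.faceSumQuad_rowKernel3_nonneg _ _ _ _
    · exact le_rfl
  · intro uv _
    refine mul_nonneg (hw uv) ?_
    split_ifs
    · exact G.faceSumQuad_rowKernel3_nonneg _ _ _ _
    · exact le_rfl
  · intro uv _
    split_ifs with huv
    · have hm := h uv.1 uv.2 a b c
      rw [← G.faceSumQuad_eq_minor ![a, b, c] kernel28 uv.1 uv.2,
        ← G.faceSumQuad_eq_minor ![a, b, c] (rowKernel3 2) uv.1 uv.2,
        ← G.faceSumQuad_eq_minor ![a, b, c] (rowKernel3 3) uv.1 uv.2] at hm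
      calc (weight p uv.2 * weight p uv.1 * G.faceSumQuad ![a, b, c] kernel28 uv.1 uv.2) ^ 2
          = (weight p uv.2 * weight p uv.1) ^ 2 *
              (G.faceSumQuad ![a, b, c] kernel28 uv.1 uv.2) ^ 2 := by ring
        _ ≤ (weight p uv.2 * weight p uv.1) ^ 2 *
              (G.faceSumQuad ![a, b, c] (rowKernel3 2) uv.1 uv.2 *
                G.faceSumQuad ![a, b, c] (rowKernel3 3) uv.1 uv.2) :=
            mul_le_mul_of_nonneg_left hm (sq_nonneg _)
        _ = (weight p uv.2 * weight p uv.1 * G.faceSumQuad ![a, b, c] (rowKernel3 2) uv.1 uv.2) *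
              (weight p uv.2 * weight p uv.1 *
                G.faceSumQuad ![a, b, c] (rowKernel3 3) uv.1 uv.2) := by ring
    · simp

end MultiGraph

/-- **The global class statement gives the per-graph one on every graph**: `C028Class` specialised
to the marked minors of `G`. -/
theorem C028ClassOn_of_C028Class (h : C028Class) {V E : Type} [Fintype E] [DecidableEq E]
    (G : MultiGraph V E) : G.C028ClassOn :=
  fun u v a b c => h (G.minor u v) (fun i => G.sureClass v (![a, b, c] i))

/-- **`C028_of_C028Class` re-derived through the per-graph wrapper** (same type as the landed
theorem; a consistency check of the restriction). -/
theorem C028_of_C028Class' (h : C028Class) : C028 :=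
  fun G p hp a b c => G.C028On_of_C028ClassOn (C028ClassOn_of_C028Class h G) p hp a b c

end PercRepro
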